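import Mathlib
import HarnessLib
import Literature.MathematicalPhysics.StatisticalMechanics.LatticePolynomialFields

/-!
# Discrete Taylor approximation of fields across scales ([ABKM19] Lemma 8.10, (8.56))

For a field `ξ` on the torus and a lattice box `S = a + [0,ρ']^d` (corner `a`, not wrapping), the
discrete Taylor polynomial `taylorField a s ξ = Σ_{|α| ≤ s} ∇^αξ(a) b_α^a` in the binomial test fields
of `LatticePolynomialFields` has the same lattice derivatives as `ξ` at `a` up to order `s` and none
of order `> s`; a telescoping ("path") lemma on the box and a downward induction on the order then
give `|∇^β(ξ − Tay_sξ)(x)| ≤ (dρ')^{s+1−|β|} M` on the box, `M = max_{x∈S,|γ|=s+1}|∇^γξ(x)|`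
(this replaces the Newton-remainder formula of [BS15II] Lemma 3.3.3 used in the source).  In the
field gauges of two consecutive scales (`T = fieldGauge 𝔥 R p S`, `T' = fieldGauge 𝔥' R' p S`,
`R' = LR`, `𝔥' ≤ κ𝔥`, `ρ' ≤ C₁R`, `s + 1 ≤ p`) this is **`norm_fieldGauge_sub_taylorField_le`**:
`‖T(ξ − Tay_sξ)‖ ≤ κ(dC₁+1)^{s+1}L^{-(s+1)}‖T'ξ‖` — [ABKM19] (8.56) with `κ = h_{k+1}𝔥-ratio =
2L^{-(d-2)/2}`, `s = ⌊d/2⌋+1`: `inf_P |ξ − P|_{k,B} ≤ C L^{-(d/2+⌊d/2⌋+1)}|ξ|_{k+1,B}`.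

* `degIndex d s` (multi-indices `|α| ≤ s`), `InBox`, `taylorField`;
* `iterDiff_taylorField`, `iterDiff_taylorField_self` (orders `≤ s` at `a`), `iterDiff_taylorField_eq_zero`
  (orders `> s`);
* `abs_le_of_fwdDiff_le` (path lemma), `abs_iterDiff_le_of_vanish` (order induction),
  `abs_iterDiff_sub_taylorField_le`, **`norm_fieldGauge_sub_taylorField_le`**.

Everything is proved; no named fact.

## References
* S. Adams, S. Buchholz, R. Kotecký, S. Müller, arXiv:1910.13564, Lemma 8.10 (8.56), (8.59)–(8.62)
  [AdamsBuchholzKoteckyMuller2019].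
* D. Brydges, G. Slade, J. Stat. Phys. 159 (2015) 461–491, Lemma 3.3.3 [BrydgesSlade2015RGII].
-/

noncomputable section

namespace Literature.MathematicalPhysics.StatisticalMechanics.GradientRG

open Finset
open Literature.MathematicalPhysics.StatisticalMechanics.GradientFRD (iterDiff)

variable {d M : ℕ} [NeZero M]

/-! ## Multi-indices of bounded degree, boxes, the Taylor field -/

/-- The multi-indices `α : Fin d → ℕ` with `|α| ≤ s`. [cite: AdamsBuchholzKoteckyMuller2019, Lemma 8.10] -/
def degIndex (d s : ℕ) : Finset (Fin d → ℕ) :=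
  (Fintype.piFinset fun _ : Fin d => Finset.range (s + 1)).filter fun α => ∑ i, α i ≤ s

/-- Membership in `degIndex`. [cite: AdamsBuchholzKoteckyMuller2019, Lemma 8.10] -/
theorem mem_degIndex {s : ℕ} {α : Fin d → ℕ} : α ∈ degIndex d s ↔ ∑ i, α i ≤ s := by
  rw [degIndex, Finset.mem_filter, Fintype.mem_piFinset]
  constructor
  · exact fun h => h.2
  · intro h
    refine ⟨fun i => Finset.mem_range.2 ?_, h⟩
    have hi : α i ≤ ∑ j, α j := Finset.single_le_sum (f := α) (fun j _ => Nat.zero_le _) (Finset.mem_univ i)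
    omega

/-- The lattice box `a + [0,ρ']^d` (in relative coordinates). [cite: AdamsBuchholzKoteckyMuller2019, Lemma 8.10 (8.58)] -/
def InBox (a : Fin d → ZMod M) (ρ' : ℕ) (x : Fin d → ZMod M) : Prop :=
  ∀ i, 0 ≤ relCoord a x i ∧ relCoord a x i ≤ ρ'

/-- **The discrete Taylor polynomial of order `s` at `a`**: `Σ_{|α| ≤ s} ∇^αξ(a) b_α^a`.
[cite: AdamsBuchholzKoteckyMuller2019, Lemma 8.10 (P = Tay_a^s ξ)] -/
def taylorField (a : Fin d → ZMod M) (s : ℕ) (ξ : (Fin d → ZMod M) → ℝ) : (Fin d → ZMod M) → ℝ :=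
  ∑ α ∈ degIndex d s, iterDiff α ξ a • polyField a α

/-! ## Lattice derivatives of the Taylor field -/

/-- `∇^γ Tay_sξ (x) = Σ_{|α|≤s, γ≤α} ∇^αξ(a) b_{α−γ}(x)` (room for `|γ|` steps at `x`).
[cite: AdamsBuchholzKoteckyMuller2019, Lemma 8.10] -/
theorem iterDiff_taylorField {a x : Fin d → ZMod M} {s n : ℕ} (ξ : (Fin d → ZMod M) → ℝ)
    (γ : Fin d → ℕ) (hγ : ∑ i, γ i ≤ n) (hx : HasRoom a x n) :
    iterDiff γ (taylorField a s ξ) x =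
      ∑ α ∈ degIndex d s, iterDiff α ξ a *
        (if (∀ i, γ i ≤ α i) then polyField a (α - γ) x else 0) := by
  unfold taylorField
  rw [← iterDiffₗ_apply, map_sum, Finset.sum_apply]
  refine Finset.sum_congr rfl fun α _ => ?_
  rw [map_smul, Pi.smul_apply, iterDiffₗ_apply, smul_eq_mul, iterDiff_polyField' hx α γ hγ]

/-- **`∇^γ Tay_sξ (a) = ∇^γξ(a)` for `|γ| ≤ s`** (room for `s` steps at `a`).
[cite: AdamsBuchholzKoteckyMuller2019, Lemma 8.10] -/
theorem iterDiff_taylorField_self {a : Fin d → ZMod M} {s : ℕ} (ha : HasRoom a a s)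
    (ξ : (Fin d → ZMod M) → ℝ) (γ : Fin d → ℕ) (hγ : ∑ i, γ i ≤ s) :
    iterDiff γ (taylorField a s ξ) a = iterDiff γ ξ a := by
  rw [iterDiff_taylorField ξ γ hγ ha]
  have hγmem : γ ∈ degIndex d s := mem_degIndex.2 hγ
  rw [Finset.sum_eq_single_of_mem γ hγmem]
  · rw [if_pos fun i => le_rfl, tsub_self, polyField_zero_index, mul_one]
  · intro α _ hαγ
    split_ifs with hle
    · rw [polyField_self]
      have hne : α - γ ≠ 0 := by
        intro h0
        apply hαγ
        funext i
        have := congrFun h0 i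
        simp only [Pi.sub_apply, Pi.zero_apply] at this
        exact le_antisymm (by omega) (hle i)
      rw [if_neg hne, mul_zero]
    · rw [mul_zero]

/-- **`∇^γ Tay_sξ = 0` for `|γ| ≥ s+1`** (room for `|γ|` steps).
[cite: AdamsBuchholzKoteckyMuller2019, Lemma 8.10] -/
theorem iterDiff_taylorField_eq_zero {a x : Fin d → ZMod M} {s n : ℕ} (ξ : (Fin d → ZMod M) → ℝ)
    (γ : Fin d → ℕ) (hγs : s + 1 ≤ ∑ i, γ i) (hγ : ∑ i, γ i ≤ n) (hx : HasRoom a x n) :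
    iterDiff γ (taylorField a s ξ) x = 0 := by
  rw [iterDiff_taylorField ξ γ hγ hx]
  refine Finset.sum_eq_zero fun α hα => ?_
  rw [if_neg, mul_zero]
  intro hle
  have h1 : ∑ i, γ i ≤ ∑ i, α i := Finset.sum_le_sum fun i _ => hle i
  have h2 := mem_degIndex.1 hα
  omega

/-! ## The path lemma and the order induction -/

/-- Stepping back in direction `i` lowers `z_i ≥ 1` by one. [cite: AdamsBuchholzKoteckyMuller2019, Lemma 8.10] -/
theorem relCoord_sub_single_self {a x : Fin d → ZMod M} {i : Fin d} (h : 1 ≤ relCoord a x i) :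
    relCoord a (x - Pi.single i 1) i = relCoord a x i - 1 := by
  unfold relCoord at *
  have hmem := ZMod.valMinAbs_mem_Ioc (x i - a i)
  rw [ZMod.valMinAbs_spec]
  refine ⟨?_, ?_, ?_⟩
  · rw [Pi.sub_apply, Pi.single_eq_same, Int.cast_sub, Int.cast_one, ZMod.coe_valMinAbs]; ring
  · have : (0 : ℤ) < M := by exact_mod_cast Nat.pos_of_ne_zero (NeZero.ne M)
    linarith
  · linarith [hmem.2]

omit [NeZero M] in
/-- Stepping in direction `i` leaves `z_j`, `j ≠ i`, unchanged. [cite: AdamsBuchholzKoteckyMuller2019, Lemma 8.10] -/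
theorem relCoord_sub_single_ne {a x : Fin d → ZMod M} {i j : Fin d} (hij : j ≠ i) :
    relCoord a (x - Pi.single i 1) j = relCoord a x j := by
  simp [relCoord, Pi.sub_apply, Pi.single_eq_of_ne hij]

omit [NeZero M] in
/-- `z = 0` only at the corner. [cite: AdamsBuchholzKoteckyMuller2019, Lemma 8.10] -/
theorem eq_of_relCoord_eq_zero {a x : Fin d → ZMod M} (h : ∀ i, relCoord a x i = 0) : x = a := by
  funext i
  have := h i
  unfold relCoord at this
  rw [ZMod.valMinAbs_eq_zero, sub_eq_zero] at this
  exact this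

/-- **Path lemma**: if `g(a) = 0` and `|∇_i g| ≤ m` along the box, then
`|g(x)| ≤ m Σ_i z_i` on the box (telescoping along a monotone lattice path).
[cite: AdamsBuchholzKoteckyMuller2019, Lemma 8.10 ("the difference h(x,y) − h(a,a) can be estimated … by the maximum of the first order forward derivatives … times |x−a|₁")] -/
theorem abs_le_of_fwdDiff_le {a : Fin d → ZMod M} {ρ' : ℕ} {g : (Fin d → ZMod M) → ℝ} {m : ℝ}
    (hm : 0 ≤ m) (h0 : g a = 0)
    (hstep : ∀ y, InBox a ρ' y → ∀ i, InBox a ρ' (y + Pi.single i 1) →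
      |GradientFRD.fwdDiff i g y| ≤ m) :
    ∀ x, InBox a ρ' x → |g x| ≤ m * ∑ i, (relCoord a x i : ℝ) := by
  -- induction on `N = Σ_i z_i` (a natural number on the box)
  have key : ∀ N : ℕ, ∀ x, InBox a ρ' x → ∑ i, relCoord a x i = N → |g x| ≤ m * ∑ i, (relCoord a x i : ℝ) := by
    intro N
    induction N with
    | zero =>
      intro x hx hN
      have hz : ∀ i, relCoord a x i = 0 := fun i => by
        have h1 : relCoord a x i ≤ ∑ j, relCoord a x j :=
          Finset.single_le_sum (f := fun j => relCoord a x j) (fun j _ => (hx j).1) (Finset.mem_univ i)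
        have h2 := (hx i).1
        push_cast at hN
        omega
      rw [eq_of_relCoord_eq_zero hz, h0, abs_zero]
      exact mul_nonneg hm (Finset.sum_nonneg fun i _ => by exact_mod_cast (by rw [relCoord_self]))
    | succ N ih =>
      intro x hx hN
      -- pick a direction with `z_i ≥ 1`
      obtain ⟨i, hi⟩ : ∃ i, 1 ≤ relCoord a x i := by
        by_contra hcon
        push Not at hcon
        have : ∑ j, relCoord a x j ≤ 0 := Finset.sum_nonpos fun j _ => by have := hcon j; omega
        omega
      set y := x - Pi.single i 1 with hy
      have hyi : relCoord a y i = relCoord a x i - 1 := relCoord_sub_single_self hi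
      have hyj : ∀ j, j ≠ i → relCoord a y j = relCoord a x j := fun j hj => relCoord_sub_single_ne hj
      have hybox : InBox a ρ' y := fun j => by
        by_cases hj : j = i
        · subst hj; rw [hyi]; constructor <;> [omega; linarith [(hx j).2]]
        · rw [hyj j hj]; exact hx j
      have hsum : ∑ j, relCoord a y j = N := by
        have : ∑ j, relCoord a y j + 1 = ∑ j, relCoord a x j := by
          rw [← Finset.sum_erase_add _ _ (Finset.mem_univ i), ← Finset.sum_erase_add _ _ (Finset.mem_univ i),
            hyi, Finset.sum_congr rfl fun j hj => hyj j (Finset.ne_of_mem_erase hj)]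
          ring
        omega
      have hxy : y + Pi.single i 1 = x := by rw [hy, sub_add_cancel]
      have hIH := ih y hybox hsum
      have hst := hstep y hybox i (by rw [hxy]; exact hx)
      unfold GradientFRD.fwdDiff at hst
      rw [hxy] at hst
      have hsumR : ∑ j, (relCoord a x j : ℝ) = ∑ j, (relCoord a y j : ℝ) + 1 := by
        have h1 : ((∑ j, relCoord a y j : ℤ) : ℝ) + 1 = ((∑ j, relCoord a x j : ℤ) : ℝ) := by
          rw [hsum, hN]; push_cast; ring
        push_cast at h1
        linarith
      rw [hsumR, mul_add, mul_one]
      calc |g x| = |g y + (g x - g y)| := by ring_nf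
        _ ≤ |g y| + |g x - g y| := abs_add_le _ _
        _ ≤ m * ∑ j, (relCoord a y j : ℝ) + m := add_le_add hIH hst
  intro x hx
  have hN : 0 ≤ ∑ i, relCoord a x i := Finset.sum_nonneg fun i _ => (hx i).1
  exact key (∑ i, relCoord a x i).toNat x hx (Int.toNat_of_nonneg hN).symm

omit [NeZero M] in
/-- `Σ_i z_i ≤ dρ'` on the box. [cite: AdamsBuchholzKoteckyMuller2019, Lemma 8.10 (|x−a|₁ ≤ dρ)] -/
theorem sum_relCoord_le_of_inBox {a x : Fin d → ZMod M} {ρ' : ℕ} (hx : InBox a ρ' x) :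
    ∑ i, (relCoord a x i : ℝ) ≤ d * ρ' := by
  calc ∑ i, (relCoord a x i : ℝ) ≤ ∑ _i : Fin d, (ρ' : ℝ) :=
        Finset.sum_le_sum fun i _ => by exact_mod_cast (hx i).2
    _ = d * ρ' := by rw [Finset.sum_const, Finset.card_univ, Fintype.card_fin, nsmul_eq_mul]

/-- **Order induction**: if all lattice derivatives of `R` of order `≤ s` vanish at the corner `a` and
those of order `s+1` are bounded by `Mt` on the box, then the order-`t` derivatives are bounded by
`(dρ')^{s+1−t} Mt` on the box. [cite: AdamsBuchholzKoteckyMuller2019, Lemma 8.10 (8.61)] -/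
theorem abs_iterDiff_le_of_vanish {a : Fin d → ZMod M} {ρ' s : ℕ} {R : (Fin d → ZMod M) → ℝ} {Mt : ℝ}
    (hMt : 0 ≤ Mt) (h0 : ∀ γ : Fin d → ℕ, ∑ i, γ i ≤ s → iterDiff γ R a = 0)
    (htop : ∀ x, InBox a ρ' x → ∀ γ : Fin d → ℕ, ∑ i, γ i = s + 1 → |iterDiff γ R x| ≤ Mt) :
    ∀ k, k ≤ s + 1 → ∀ γ : Fin d → ℕ, ∑ i, γ i = s + 1 - k → ∀ x, InBox a ρ' x →
      |iterDiff γ R x| ≤ ((d : ℝ) * ρ') ^ k * Mt := by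
  intro k
  induction k with
  | zero =>
    intro _ γ hγ x hx
    rw [pow_zero, one_mul]
    exact htop x hx γ (by omega)
  | succ k ih =>
    intro hk γ hγ x hx
    have hdρ : (0 : ℝ) ≤ (d : ℝ) * ρ' := by positivity
    -- the path lemma for `g = ∇^γ R`
    have hg0 : iterDiff γ R a = 0 := h0 γ (by omega)
    have hpath := abs_le_of_fwdDiff_le (g := iterDiff γ R) (m := ((d : ℝ) * ρ') ^ k * Mt) (by positivity) hg0
      (fun y hy i _ => by
        rw [← congrFun (iterDiff_add_single γ i R) y]
        exact ih (by omega) (γ + Pi.single i 1) (by rw [sum_add_single]; omega) y hy) x hx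
    calc |iterDiff γ R x| ≤ ((d : ℝ) * ρ') ^ k * Mt * ∑ i, (relCoord a x i : ℝ) := hpath
      _ ≤ ((d : ℝ) * ρ') ^ k * Mt * ((d : ℝ) * ρ') :=
          mul_le_mul_of_nonneg_left (sum_relCoord_le_of_inBox hx) (by positivity)
      _ = ((d : ℝ) * ρ') ^ (k + 1) * Mt := by rw [pow_succ]; ring

/-- **Taylor remainder on the box** ([ABKM19] (8.61)): for `x` in the box `a + [0,ρ']^d` (room for
`s+1` steps on the box) and `|β| = t ≤ s`,
`|∇^β(ξ − Tay_sξ)(x)| ≤ (dρ')^{s+1−t} · max_{box, |γ|=s+1}|∇^γξ|`.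
[cite: AdamsBuchholzKoteckyMuller2019, Lemma 8.10 (8.61)] -/
theorem abs_iterDiff_sub_taylorField_le {a : Fin d → ZMod M} {ρ' s : ℕ} (ha : InBox a ρ' a)
    (hroom : ∀ x, InBox a ρ' x → HasRoom a x (s + 1)) (ξ : (Fin d → ZMod M) → ℝ) {Mt : ℝ}
    (hMt : 0 ≤ Mt)
    (htop : ∀ x, InBox a ρ' x → ∀ γ : Fin d → ℕ, ∑ i, γ i = s + 1 → |iterDiff γ ξ x| ≤ Mt)
    {t : ℕ} (ht : t ≤ s) (β : Fin d → ℕ) (hβ : ∑ i, β i = t) {x : Fin d → ZMod M} (hx : InBox a ρ' x) :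
    |iterDiff β (ξ - taylorField a s ξ) x| ≤ ((d : ℝ) * ρ') ^ (s + 1 - t) * Mt := by
  have hlin : ∀ γ : Fin d → ℕ, ∀ y, iterDiff γ (ξ - taylorField a s ξ) y =
      iterDiff γ ξ y - iterDiff γ (taylorField a s ξ) y := fun γ y => by
    rw [← iterDiffₗ_apply, map_sub]; rfl
  have h0 : ∀ γ : Fin d → ℕ, ∑ i, γ i ≤ s → iterDiff γ (ξ - taylorField a s ξ) a = 0 := by
    intro γ hγ
    rw [hlin, iterDiff_taylorField_self ((hroom a ha).mono (by omega)) ξ γ hγ, sub_self]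
  have htop' : ∀ y, InBox a ρ' y → ∀ γ : Fin d → ℕ, ∑ i, γ i = s + 1 →
      |iterDiff γ (ξ - taylorField a s ξ) y| ≤ Mt := by
    intro y hy γ hγ
    rw [hlin, iterDiff_taylorField_eq_zero ξ γ (by omega) (le_of_eq hγ) (hroom y hy), sub_zero]
    exact htop y hy γ hγ
  have hk : s + 1 - t ≤ s + 1 := by omega
  have hβ' : ∑ i, β i = s + 1 - (s + 1 - t) := by omega
  exact abs_iterDiff_le_of_vanish hMt h0 htop' (s + 1 - t) hk β hβ' x hx

/-! ## The gauge form across two scales -/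

/-- **[ABKM19] Lemma 8.10 (8.56) in gauge form.** For the box `S = a + [0,ρ']^d` (room for `p` steps),
gauges `T = fieldGauge 𝔥 R p S`, `T' = fieldGauge 𝔥' R' p S` with `R' = LR`, `L ≥ 1`, `𝔥' ≤ κ𝔥`,
`ρ' ≤ C₁R` and `s + 1 ≤ p`:  `‖T(ξ − Tay_sξ)‖ ≤ κ(dC₁+1)^{s+1}L^{-(s+1)}‖T'ξ‖`.
[cite: AdamsBuchholzKoteckyMuller2019, Lemma 8.10 (8.56)] -/
theorem norm_fieldGauge_sub_taylorField_le {a : Fin d → ZMod M} {ρ' s p : ℕ}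
    {S : Finset (Fin d → ZMod M)} (hS : ∀ x, x ∈ S ↔ InBox a ρ' x) (ha : InBox a ρ' a)
    (hroom : ∀ x ∈ S, HasRoom a x p) (hsp : s + 1 ≤ p) {𝔥 𝔥' R R' L κ C₁ : ℝ} (h𝔥 : 0 < 𝔥)
    (h𝔥' : 0 < 𝔥') (hR : 0 < R) (hL : 1 ≤ L) (hRR : R' = L * R) (hκ : 𝔥' ≤ κ * 𝔥) (hC₁ : 0 ≤ C₁)
    (hρ : (ρ' : ℝ) ≤ C₁ * R) (ξ : (Fin d → ZMod M) → ℝ) :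
    ‖fieldGauge 𝔥 R p S (ξ - taylorField a s ξ)‖ ≤
      κ * ((d : ℝ) * C₁ + 1) ^ (s + 1) / L ^ (s + 1) * ‖fieldGauge 𝔥' R' p S ξ‖ := by
  set T' := fieldGauge 𝔥' R' p S with hT'
  set n' := ‖T' ξ‖ with hn'
  have hn'0 : 0 ≤ n' := norm_nonneg _
  have hR' : 0 < R' := by rw [hRR]; positivity
  have hκ0 : 0 ≤ κ := by nlinarith
  have hL0 : 0 < L := by linarith
  -- the top-order bound from `T'`
  set Mt : ℝ := 𝔥' * (R' ^ (s + 1))⁻¹ * n' with hMt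
  have hMt0 : 0 ≤ Mt := by positivity
  have hcomp : ∀ x ∈ S, ∀ γ : Fin d → ℕ, 1 ≤ ∑ i, γ i → ∑ i, γ i ≤ p →
      |iterDiff γ ξ x| ≤ 𝔥' * (R' ^ (∑ i, γ i))⁻¹ * n' := by
    intro x hx γ hγ1 hγp
    have hq := norm_le_pi_norm (T' ξ) ⟨⟨x, hx⟩, ⟨γ, mem_diffIndex.2 ⟨hγ1, hγp⟩⟩⟩
    rw [hT', fieldGauge_apply, Real.norm_eq_abs, abs_mul, abs_mul, abs_inv, abs_of_pos h𝔥',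
      abs_of_pos (by positivity)] at hq
    simp only at hq
    rw [show 𝔥' * (R' ^ (∑ i, γ i))⁻¹ * n' = n' / (𝔥'⁻¹ * R' ^ (∑ i, γ i)) by field_simp,
      le_div_iff₀ (by positivity)]
    calc |iterDiff γ ξ x| * (𝔥'⁻¹ * R' ^ ∑ i, γ i) = 𝔥'⁻¹ * R' ^ (∑ i, γ i) * |iterDiff γ ξ x| := by ring
      _ ≤ n' := hq
  have htop : ∀ x, InBox a ρ' x → ∀ γ : Fin d → ℕ, ∑ i, γ i = s + 1 → |iterDiff γ ξ x| ≤ Mt := by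
    intro x hx γ hγ
    have := hcomp x ((hS x).2 hx) γ (by omega) (by omega)
    rwa [hγ] at this
  have hroom' : ∀ x, InBox a ρ' x → HasRoom a x (s + 1) := fun x hx => (hroom x ((hS x).2 hx)).mono hsp
  -- componentwise
  refine (pi_norm_le_iff_of_nonneg (by positivity)).2 fun q => ?_
  obtain ⟨⟨x, hx⟩, ⟨β, hβ⟩⟩ := q
  have hxbox : InBox a ρ' x := (hS x).1 hx
  obtain ⟨hβ1, hβp⟩ := mem_diffIndex.1 hβ
  set t := ∑ i, β i with ht
  rw [fieldGauge_apply, Real.norm_eq_abs, abs_mul, abs_mul, abs_inv, abs_of_pos h𝔥, abs_of_pos (by positivity)]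
  simp only
  have hdC : (1 : ℝ) ≤ (d : ℝ) * C₁ + 1 := by nlinarith [Nat.cast_nonneg (α := ℝ) d]
  by_cases hts : t ≤ s
  · -- low order: the Taylor remainder
    have hrem := abs_iterDiff_sub_taylorField_le ha hroom' ξ hMt0 htop hts β ht.symm hxbox
    have hρd : (d : ℝ) * ρ' ≤ (d : ℝ) * C₁ * R := by nlinarith [Nat.cast_nonneg (α := ℝ) d]
    have hpow : ((d : ℝ) * ρ') ^ (s + 1 - t) ≤ ((d : ℝ) * C₁ * R) ^ (s + 1 - t) :=
      pow_le_pow_left₀ (by positivity) hρd _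
    have hMt' : Mt ≤ κ * 𝔥 * (R' ^ (s + 1))⁻¹ * n' := by
      simp only [hMt]; gcongr
    calc 𝔥⁻¹ * R ^ t * |iterDiff β (ξ - taylorField a s ξ) x|
        ≤ 𝔥⁻¹ * R ^ t * (((d : ℝ) * ρ') ^ (s + 1 - t) * Mt) := by gcongr
      _ ≤ 𝔥⁻¹ * R ^ t * (((d : ℝ) * C₁ * R) ^ (s + 1 - t) * (κ * 𝔥 * (R' ^ (s + 1))⁻¹ * n')) :=
          mul_le_mul_of_nonneg_left (mul_le_mul hpow hMt' hMt0 (by positivity)) (by positivity)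
      _ = κ * ((d : ℝ) * C₁) ^ (s + 1 - t) / L ^ (s + 1) * n' := by
          have hRpow : R ^ (s + 1) = R ^ t * R ^ (s + 1 - t) := by rw [← pow_add]; congr 1; omega
          rw [hRR, mul_pow ((d : ℝ) * C₁) R, mul_pow L R, hRpow]
          field_simp
      _ ≤ κ * ((d : ℝ) * C₁ + 1) ^ (s + 1) / L ^ (s + 1) * n' := by
          gcongr
          calc ((d : ℝ) * C₁) ^ (s + 1 - t) ≤ ((d : ℝ) * C₁ + 1) ^ (s + 1 - t) :=
                pow_le_pow_left₀ (by positivity) (by linarith) _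
            _ ≤ ((d : ℝ) * C₁ + 1) ^ (s + 1) := pow_le_pow_right₀ hdC (by omega)
  · -- high order: the Taylor field is invisible
    have hts' : s + 1 ≤ t := by omega
    have hlin : iterDiff β (ξ - taylorField a s ξ) x = iterDiff β ξ x := by
      rw [← iterDiffₗ_apply, map_sub, Pi.sub_apply, iterDiffₗ_apply, iterDiffₗ_apply,
        iterDiff_taylorField_eq_zero ξ β hts' hβp (hroom x hx), sub_zero]
    rw [hlin]
    have hc := hcomp x hx β hβ1 hβp
    calc 𝔥⁻¹ * R ^ t * |iterDiff β ξ x| ≤ 𝔥⁻¹ * R ^ t * (𝔥' * (R' ^ t)⁻¹ * n') := by gcongr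
      _ ≤ 𝔥⁻¹ * R ^ t * (κ * 𝔥 * (R' ^ t)⁻¹ * n') := by gcongr
      _ = κ / L ^ t * n' := by rw [hRR, mul_pow]; field_simp
      _ ≤ κ * ((d : ℝ) * C₁ + 1) ^ (s + 1) / L ^ (s + 1) * n' := by
          refine mul_le_mul_of_nonneg_right ?_ hn'0
          calc κ / L ^ t ≤ κ / L ^ (s + 1) :=
                div_le_div_of_nonneg_left hκ0 (by positivity) (pow_le_pow_right₀ hL hts')
            _ ≤ κ * ((d : ℝ) * C₁ + 1) ^ (s + 1) / L ^ (s + 1) :=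
                div_le_div_of_nonneg_right (le_mul_of_one_le_right hκ0 (one_le_pow₀ hdC)) (by positivity)

end Literature.MathematicalPhysics.StatisticalMechanics.GradientRG

end
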